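import Summits.BirchSwinnertonDyer.BirchSwinnertonDyer.Theorems.KimAtThreeFineKatoKPortInertia
import Mathlib.LinearAlgebra.LinearIndependent.Basic
import HarnessLib

/-!
# K-PORT glue (toward `hres`, step r3 + G6): an UNRAMIFIED finite Galois `K ⊇ ℚ_p` has an integer of
# UNIT TRACE — `∃ a ∈ 𝒪_K, ‖∑_σ σ a‖ = 1` (the residue traces `∑_σ σ̄` do not all vanish)
# (cell `bsd-addord`, seat w2-kport gen 2; `--supports stmt-BirchSwinnertonDyer-19560`, helper)

HONEST FRAMING. Route W2 (`route-BirchSwinnertonDyer-KimAtThreeKolyvagin`), crux 19560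
`KatoKuriharaPortThreeShared`, residual ⟨C1⟩ clause (C1.c), hypothesis `hres` of gen 0's
`KPort.consumer_of_exists_norm_not_mem_kernel`. In the residue-field proof of `hres` the norm
`N(P) = ∑_σ σP` of a point reduces to `∑_σ σ̄(r(P̃))` in `k⁺ ≅ Ẽ_ns(k)`; one needs an element of `k`
on which `∑_σ σ̄` does not vanish. This file proves exactly that, in the port's `K`-level currency:

  `exists_norm_sum_galois_eq_one`: for `K/ℚ_p` finite with `𝔪_K = p𝒪_K` (`hK`) there is `a ∈ 𝒪_K`
  with `‖∑_{σ ∈ Aut_{ℚ_p}(K)} σ a‖ = 1`,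

i.e. `Tr_{K/ℚ_p}(𝒪_K) ⊄ pℤ_p` when `K/ℚ_p` is Galois (`exists_norm_trace_eq_one`). PROOF: by
`…KPortInertia` (`σ̄ = τ̄ ⇒ σ = τ`) the residue automorphisms `σ̄ : k → k` are pairwise distinct, hence
linearly independent over `k` (Artin/Dedekind, Mathlib `linearIndependent_monoidHom`), so `∑_σ σ̄ ≠ 0`.
The maps `σ|_𝒪` and `σ̄` are built inside the proof (Mathlib `RingHom.codRestrict`,
`IsLocalRing.ResidueField.map`); no definition is introduced. TOOL theorems only (no definition, no
named fact, no `sorry`); closes nothing by itself; nothing booked.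

References: J.-P. Serre, *Local Fields* (1979), Ch. I §7, Ch. III §5 (the different of an unramified
extension is trivial) [SerreLocalFields1979]; E. Artin, linear independence of characters, as in Mathlib
`linearIndependent_monoidHom` [folklore].
-/

noncomputable section

-- the cell's Theorems namespace `Summit.BirchSwinnertonDyer.BirchSwinnertonDyer.…` repeats the summit name by design (D-0017)
set_option linter.dupNamespace false

open scoped Classical NNReal

namespace Summit.BirchSwinnertonDyer.BirchSwinnertonDyer.Theorems.KPort

open Summit.BirchSwinnertonDyer.Rank1Residual.Additive.BallEval
open Literature.NumberTheory.GaloisRepresentations.LubinTate (unitBall mem_unitBall_iff)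

variable {p : ℕ} [hp : Fact p.Prime] {K : Type*} [NontriviallyNormedField K] [NormedAlgebra ℚ_[p] K]
  [IsUltrametricDist K] [FiniteDimensional ℚ_[p] K]

/-- A unit of `𝒪_K` has norm `1`, and conversely. [folklore] -/
theorem isUnit_unitBall_iff_norm_eq_one (a : unitBall K) : IsUnit a ↔ ‖(a : K)‖ = 1 := by
  have hv := Valuation.integer.integers (NormedField.valuation (K := K))
  rw [hv.isUnit_iff_valuation_eq_one]
  change NormedField.valuation (K := K) (a : K) = 1 ↔ _
  rw [← NNReal.coe_inj, NormedField.valuation_apply, coe_nnnorm, NNReal.coe_one]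

/-- **An integer of unit trace in an unramified `K/ℚ_p`.** For `K` a finite-dimensional complete
ultrametric `ℚ_p`-field with `𝔪_K = p𝒪_K` (`hK`) there is `a ∈ 𝒪_K` with `‖∑_{σ ∈ Aut_{ℚ_p} K} σ a‖ = 1`:
the residue characters `σ̄` are pairwise distinct (`…KPortInertia`), hence `k`-linearly independent,
so `∑_σ σ̄ ≠ 0` on `k = 𝒪_K/𝔪_K`. [cite: SerreLocalFields1979, Ch. I §7 and Ch. III §5] -/
theorem exists_norm_sum_galois_eq_one (hK : ∀ x : K, ‖x‖ < 1 → ‖x‖ ≤ ‖(p : K)‖) :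
    ∃ a : K, ‖a‖ ≤ 1 ∧ ‖∑ σ : K ≃ₐ[ℚ_[p]] K, σ a‖ = 1 := by
  haveI : Algebra.IsAlgebraic ℚ_[p] K := Algebra.IsAlgebraic.of_finite ℚ_[p] K
  -- `σ|_𝒪 : 𝒪 →+* 𝒪`
  let σO : (K ≃ₐ[ℚ_[p]] K) → (unitBall K →+* unitBall K) := fun σ =>
    ((σ : K →+* K).comp (unitBall K).subtype).codRestrict (unitBall K) fun a =>
      (mem_unitBall_iff K).mpr (norm_galois_le_one σ ((mem_unitBall_iff K).mp a.2))
  have σO_coe : ∀ σ (a : unitBall K), ((σO σ a : unitBall K) : K) = σ a := fun σ a => rfl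
  haveI hloc : ∀ σ, IsLocalHom (σO σ) := fun σ =>
    ⟨fun a ha => by
      rw [isUnit_unitBall_iff_norm_eq_one] at ha ⊢
      rw [σO_coe, norm_algEquiv_eq] at ha
      exact ha⟩
  -- `σ̄ : k →+* k`
  let σk : (K ≃ₐ[ℚ_[p]] K) → (IsLocalRing.ResidueField (unitBall K) →* IsLocalRing.ResidueField (unitBall K)) :=
    fun σ => (IsLocalRing.ResidueField.map (σO σ)).toMonoidHom
  have σk_apply : ∀ σ (a : unitBall K), σk σ (IsLocalRing.residue (unitBall K) a) =
      IsLocalRing.residue (unitBall K) (σO σ a) := fun σ a => rfl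
  -- distinct residue characters
  have hinj : Function.Injective σk := by
    intro σ τ hστ
    refine algEquiv_eq_of_forall_norm_sub_lt_one hK σ τ fun x hx => ?_
    have h := DFunLike.congr_fun hστ (IsLocalRing.residue (unitBall K) ⟨x, (mem_unitBall_iff K).mpr hx⟩)
    rw [σk_apply, σk_apply, residue_eq_residue_iff_norm_sub_lt_one] at h
    exact h
  -- linear independence of characters ⇒ `∑ σ̄ ≠ 0`
  have hli := (linearIndependent_monoidHom (IsLocalRing.ResidueField (unitBall K))
    (IsLocalRing.ResidueField (unitBall K))).comp σk hinj
  rw [Fintype.linearIndependent_iff] at hli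
  have hne : (∑ σ : K ≃ₐ[ℚ_[p]] K, ((σk σ : IsLocalRing.ResidueField (unitBall K) →* _) :
      IsLocalRing.ResidueField (unitBall K) → IsLocalRing.ResidueField (unitBall K))) ≠ 0 := by
    intro h0
    have h1 := hli (fun _ => 1) (by simpa only [one_smul, Function.comp_apply] using h0)
    exact one_ne_zero (h1 1)
  obtain ⟨ω, hω⟩ := Function.ne_iff.mp hne
  rw [Finset.sum_apply, Pi.zero_apply] at hω
  obtain ⟨a₀, rfl⟩ := IsLocalRing.residue_surjective ω
  refine ⟨a₀, (mem_unitBall_iff K).mp a₀.2, ?_⟩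
  have key := (norm_sum_eq_one_iff_residue_sum_ne_zero (Finset.univ : Finset (K ≃ₐ[ℚ_[p]] K))
    (fun σ => σO σ a₀)).mpr (by simpa only [σk_apply] using hω)
  simpa only [σO_coe] using key

/-- The same in TRACE language for `K/ℚ_p` Galois: some `a ∈ 𝒪_K` has `‖Tr_{K/ℚ_p} a‖ = 1`
(`Tr_{K/ℚ_p}(𝒪_K) = ℤ_p`: the different of an unramified extension is trivial).
[cite: SerreLocalFields1979, Ch. III §5] -/
theorem exists_norm_trace_eq_one [IsGalois ℚ_[p] K] (hK : ∀ x : K, ‖x‖ < 1 → ‖x‖ ≤ ‖(p : K)‖) :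
    ∃ a : K, ‖a‖ ≤ 1 ∧ ‖Algebra.trace ℚ_[p] K a‖ = 1 := by
  obtain ⟨a, ha, hsum⟩ := exists_norm_sum_galois_eq_one hK
  refine ⟨a, ha, ?_⟩
  rw [← norm_algebraMap' K (Algebra.trace ℚ_[p] K a), trace_eq_sum_automorphisms]
  exact hsum

end Summit.BirchSwinnertonDyer.BirchSwinnertonDyer.Theorems.KPort

end
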